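import Summits.BirchSwinnertonDyer.Rank1Residual.ManinAdditive.CMOptimalCoordinates
import Summits.BirchSwinnertonDyer.Rank1Residual.ManinAdditive.CMLatticeSqueezeCorollaries
import Literature.NumberTheory.EllipticCurves.ComplexMultiplication
import Literature.NumberTheory.EllipticCurves.ModularCurve
import Literature.NumberTheory.EllipticCurves.ModularSymbols
import Literature.NumberTheory.EllipticCurves.ModularSymbolsLattice
import Literature.NumberTheory.EllipticCurves.Isogeny
import Literature.NumberTheory.EllipticCurves.IsogenyIdProofs
import Literature.NumberTheory.EllipticCurves.ManinConstantClassCertificate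
import Literature.NumberTheory.EllipticCurves.ManinConstantGamma1ModularDegree
import Literature.AlgebraicGeometry.PlaneCurves.HessePencilHarmonicMembers
import HarnessLib

/-!
# CM TWIN STEVENS-MINIMALITY: two laws, not three — E-es-133⁺, COR 6⁺/7⁺, the rerooting, the ROOT LAWS E-es-136/137
(cell `bsd-f2-manin`, planner `-es` g30, MEMO-es §44; T-es-47 part 1/2)

TYPER NOTE (typer g19, T-es-47).  SOURCE = HOME/es/g30/Sketch-es-g30.lean sha16 1665c8a0c824a273 (582 l.; es: farm rc 0 · 0 err · 0 warn ·
0 s∗rry, axioms standard; BC7 Probe-es-g30 23703ed6e3388cdf + Probe2 27b2571074cef701 8/8 + Probe3 5f1e21d9cfcd1ead 3/3 VERDICT CLEAN;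
censuses CM-REROOT-v1 54fa4276c4abf38c, BAND-STRATA-v1 92642dea976d938a, VELU-CHECK-v1 b06c06372f557db2), §3–§6 VERBATIM in THIS file and
§7–§8 VERBATIM in the sibling `CMTwinStevensMinimalNetCount.lean` (split for the 400-line cap), except: (i) namespace
`…ManinAdditive.KatoCurve.CMTwinMinimal` (es's suggestion; the scratch file used `BsdF2ManinEsG30`) with `open …KatoCurve.CMOptimal`;
(ii) es's copy of `isNewformOf_of_isIsogenous` is NOT re-declared — it is statement-identical to the tree's
`…KatoCurve.CMOptimal.isNewformOf_of_isIsogenous` (`CMLatticeSqueezeCorollaries.lean`, p714579), which is imported and used instead (gate dedup);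
(iii) this note.  `@[conjecture]` on the six cell laws E-es-133⁺₂/₃ (`CMTwinStevensMinimalTwo/Three` — provable on paper per es, not yet in the
tree), E-es-136₂/₃ (`CMRootGammaOneLatticeLawTwoLocal/ThreeLocal`), E-es-137₂/₃ (`CMRootPeriodLatticeLawTwoLocal/ThreeLocal`); the SUPPORTS
`CMClassShapeTwo` (classical), `CMUnitTwistOptimalCoordinatesTwo` (MEMO-es THM 42.19: print + tree modulo Stevens 1989 Thm (7.1) at 32/64) are
plain `def … : Prop` hypotheses, nothing asserted.  Imports = es's (all tree leaves / Literature) + `CMLatticeSqueezeCorollaries` — ROUTE-INDEPENDENT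
(no `Theses` module in the cone).  Refuter verdicts: R-es-67 pending at landing time.  NOT IN PRINT: E-es-133⁺ off the unit classes, E-es-136 off
`a = ±1` / conductor ≤ 200, E-es-137 (Cremona-optimality law on CM root classes) — nearest print Stevens 1989 Thm (2.3), (5.1)–(5.3), (7.1).
FALSIFIERS: D-es-g30-1 (Stevens I″ at 576a1/576e1), D-es-g30-2 (X₁-optimal curve + parity of c₁ at 256b/256c/288a/576f).
PARTITION 0 · beyond-print theorem: no · bears_on stmt-BirchSwinnertonDyer-22967 (C2, ℚ(i)-CM slice) and stmt-BirchSwinnertonDyer-22968 (C3,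
ℚ(√−3)-CM slice) · BSD is not proved by this; Manin's conjecture, C2, C3 are not proved by this.

ES'S HEADER (verbatim):

## Sketch-es-g30 — TWO LAWS, NOT THREE: the twist-reduced CM twin is Stevens-minimal in its WHOLE isogeny class,
## so the optimal curve's `j`-invariant never has to be located (cell `bsd-f2-manin`, planner `es` g30, MEMO-es §44)

LENS: Euler-system / explicit-reciprocity (Stevens 1989 §6 transplanted to `K = ℚ(i)`, `ℚ(√−3)`; here the §5 twist /
rerooting half: Thm 5.1, Lemma 5.2, Cor 5.3).

WHAT IS NEW RELATIVE TO Sketch-es-g29 (§43).  g29's corollaries 6/7 reduce C2/C3 on the CM bands to THREE typed laws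
`E-es-134_p ∧ E-es-133_p ∧ E-es-135_p`, the third (`CMOptimalIsFullCM…`: «the `X₀`-optimal curve of a `ℚ(i)`/`ℚ(√−3)`-CM
class has `j = 1728` / `j = 0`») being needed only to feed the hypothesis `W.j = 1728` of E-es-133.  This file removes it:

§1–§2  USED FROM THE TREE (T-es-46 landed 10:53Z as `…ManinAdditive.CMLatticeSqueeze`, namespace `…KatoCurve.CMOptimal`):
    `primeSaturation`, SQUEEZE (A)/(B) `maninConstant_eq_one_or_eq_neg_one_of_cuspSymbol_mem` /
    `not_dvd_maninConstant_of_saturated_cuspSymbol_mem`, the laws `CMPeriodLatticeLawTwoLocal/ThreeLocal` (E-es-134),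
    `CMTwinLatticeLeTwo/Three` (E-es-133), `CMOptimalIsFullCMTwo/Three` (E-es-135); T2Λ/T3Λ `CMPeriodLatticeLawTwo/Three`
    from `…CMOptimalCoordinates`.  Nothing is re-declared here.
§3  NEW TYPED LAW E-es-133⁺ `CMTwinStevensMinimalTwo` / `CMTwinStevensMinimalThree`: the twist-reduced twin `V` satisfies
    `Λ(V) ⊆ Λ(W)` for EVERY globally minimal `W` isogenous to `V` — the `j = 287496` (resp. `54000`, `−12288000`) members
    included.  (E-es-133 = the same with `W.j = 1728` / `W.j = 0`.)  PROVABLE NOW on paper: the non-full-CM members are the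
    Vélu quotients `[0,0,0,−11d²,∓14d³]` of `[0,0,0,−d²,0]`, `[0,0,0,−44D²,∓112D³]` of `[0,0,0,−4D²,0]` ← `[0,0,0,D²,0]`,
    `[0,0,0,−15c²,22c³]` / `[0,0,0,−135c²,−594c³]` of `[0,0,0,0,c³]` / `[0,0,0,0,−27c³]`, and the two `j = −12288000` quotients of
    `27a3 ⊗ χ`, by separable isogenies that are ÉTALE on the minimal models (`φ^*ω = ±ω`, hence `Λ(source) ⊆ Λ(target)`),
    composed with the E-es-133 twin inclusions; BC5 = census CM-REROOT-v1 (sha16 54fa4276c4abf38c): `V` is the UNIQUE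
    Stevens-minimal member in 649/649 (`ℚ(i)`) and 1848/1848 (`ℚ(√−3)`) classes of conductor `< 500 000`, two period engines
    (AGM / Carlson), max rounding margin `1.9·10⁻¹³`, 0 disagreements.
§4  COROLLARIES 6⁺/7⁺ (kernel-checked): `E-es-134₂^loc ∧ E-es-133⁺₂ ⟹ (2² ∣ N → 2 ∤ c(D))` for every optimal datum `D` of ANY
    globally minimal `W` isogenous to a `j = 1728` curve whose twist-reduced twin is off conductors 32, 64 — C2's literal
    shape, no `W.j` hypothesis, no E-es-135; likewise `p = 3` off conductor 27; and the full squeezes `c(D) = ±1` from T2Λ/T3Λ.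
§5  E-es-135 ANYWAY (the finite rerooting, typed at `p = 2`): `CMClassShapeTwo` (classical: a globally minimal curve isogenous
    to a `j = 1728` curve has `j = 1728` or `(c₄, c₆) = (528d², 12096d³)`, `d` squarefree — ONE formula covering the `32a3 ⊗ χ_d`
    (`d` odd) and `64a2 ⊗ χ_D` (`d = 2D`) families; census 174/174 curves) and `CMUnitTwistOptimalCoordinatesTwo` (the optimal
    curve of the class of such a curve is `[0,0,0,−d*²,0]` (`d` odd, `d² ≠ 1`), `[0,0,0,D*²,0]` (`d = 2D`, `D² ≠ 1`), `32a1`, `64a1` —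
    MEMO-es THEOREM 42.19 (`E₀(K ⊗ χ_D) = E∗(K) ⊗ χ_D`, print + tree mod Stevens' Thm (7.1) at `M ∈ {32, 64}`) + Cremona's table at
    32, 64; census 85/85 + 2/2) IMPLY g29's `CMOptimalIsFullCMTwo` (kernel-checked below, using Carayol's level = conductor).
    At `p = 3` the same rerooting runs over EIGHT roots {27a, 432a, 1728a, 1728v | 36a, 144a, 576a, 576e} and is a print theorem
    for six of them, CONDITIONAL on Stevens' Conjecture I″ for the two roots 576a, 576e (`36a` is additive at 2, so Thm 5.1
    cannot reroot them to level ≤ 200) — MEMO-es §44.B; not typed here.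
§6  THE REMAINING LAW SPLITS ALONG QUADRATIC TWISTS (MEMO-es §44.C): a twist-reduced twin is `E_A = [0,0,0,A,0]`,
    `A = a·b²` (`a`, `b` squarefree, `b` odd), `E_A = E_a ⊗ χ_{±b}`; for NON-ROOT classes (`b ≠ 1`) E-es-134₂^loc at `E_A`
    follows (paper THEOREM 44.C: tree LEMMA⁺ `GaussSumMulMemGamma1OfMemGamma0Twist` + the transfer inclusion
    `[Γ₀(M):Γ₀(Mp)]·Λ(g;Γ₀(M)) ⊆ Λ(g;Γ₀(Mp))` (odd index) + Stevens' Lemma (5.2) (`η = 1`, tree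
    `stevens1989_neronLattice_quadraticTwist_oddPrime_holds`) at the good odd primes of `b` + Connell's `ũ = 1` at the additive
    ones) from the 2-primary STEVENS ROOT LAW E-es-136₂ `CMRootGammaOneLatticeLawTwoLocal` («`Λ₁(f_a) ⊆ Λ(E_a)` up to odd
    index», i.e. the `X₁`-optimal curve of the class of `E_a` is `E_a` with odd `Γ₁`-Manin constant; in print only at `a = ±1`,
    Stevens Thm (7.1)); on ROOT classes E-es-134₂^loc is its literal restriction E-es-137₂ `CMRootPeriodLatticeLawTwoLocal`
    (BC5: `E₀ = E_a` in 123/123 root classes `a ≠ ±1` of conductor `< 5·10⁵`).  BAND-STRATA-v1: 649 = 125 root + 213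
    cube-free-twisted + 311 cube-stratum classes; `j = 0`: `B = c·d³` likewise (E-es-136₃ / E-es-137₃).  The ES-lens ceiling is
    thereby placed exactly: the printed instances of E-es-136 are the unit roots (`2 ∣ w_{ℚ(i)} = 4`, `3 ∣ w_{ℚ(√−3)} = 6`).

Nothing in §2, §3, §5 is asserted; the theorems of §4–§5 are implications.  BSD is not proved by this; Manin's conjecture
is not proved by this; C2 (`ManinOddAtFour`) and C3 (`ManinPrimeToThreeAtNine`) remain OPEN.
-/

set_option autoImplicit false

noncomputable section

namespace Summit.BirchSwinnertonDyer.Rank1Residual.ManinAdditive.KatoCurve.CMTwinMinimal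

open scoped MatrixGroups ModularForm
open CongruenceSubgroup WeierstrassCurve Literature.NumberTheory.EllipticCurves
  Literature.NumberTheory.EllipticCurves.ModularForms
  Summit.BirchSwinnertonDyer.Rank1Residual.ManinAdditive.KatoCurve.CMOptimal

/-! ## §3 NEW: E-es-133⁺ — the twist-reduced twin is Stevens-minimal in the WHOLE class -/

section Laws

/-- **E-es-133⁺₂ `CMTwinStevensMinimalTwo`.**  `V` globally minimal with `j(V) = 1728` and TWIST-REDUCED in its class
(every globally minimal `j = 1728` member `W'` has `c₄(W') ∈ {c₄(V), −4c₄(V)}`, i.e. `v₂(A) ≤ 1` for `V ≅ [0,0,0,A,0]`);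
`W` ANY globally minimal curve isogenous to `V` (so `j(W) ∈ {1728, 287496}`); `LV`, `LW` their Néron lattices.  Then
`Λ(V) ⊆ Λ(W)`: `V` is Stevens' minimal curve `E∗` of the class (Stevens 1989 Thm (2.3): `ℒ(A∗) ⊆ ℒ(A)` for all `A` in the class
characterises `A∗`).  Why it might fail: only if some `j = 287496` member were reached from `V` through a non-étale step —
the explicit Vélu models `[0,0,0,−11d²,∓14d³] ← [0,0,0,−d²,0]` (`d` odd) and `[0,0,0,−44D²,∓112D³] ← [0,0,0,−4D²,0] ← [0,0,0,D²,0]`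
are minimal and the maps preserve `dx/2y`, so it does not; census CM-REROOT-v1: 649/649, `V` the unique minimal member.
[cite: Stevens1989, Thm. (2.3), §5] [an §78.9 (1)–(3)] -/
@[conjecture]
def CMTwinStevensMinimalTwo : Prop :=
  ∀ (V W : WeierstrassCurve ℚ) [V.IsElliptic] [V.IsGloballyMinimal] [W.IsElliptic] [W.IsGloballyMinimal]
    (LV LW : PeriodPair),
    V.j = 1728 → WeierstrassCurve.IsIsogenous V W →
    IsNeronLatticeOf (V.baseChange ℂ) LV → IsNeronLatticeOf (W.baseChange ℂ) LW →
    (∀ (W' : WeierstrassCurve ℚ) [W'.IsElliptic] [W'.IsGloballyMinimal],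
        W'.j = 1728 → WeierstrassCurve.IsIsogenous V W' → (W'.c₄ = V.c₄ ∨ W'.c₄ = -4 * V.c₄)) →
    LV.lattice ≤ LW.lattice

/-- **E-es-133⁺₃ `CMTwinStevensMinimalThree`.**  Same at `j = 0`: `V` twist-reduced (`c₆(W') ∈ {c₆(V), −27c₆(V)}` for the
`j = 0` members, i.e. `v₃(B) ≤ 2` for `V ≅ [0,0,0,0,B]`), `W` ANY globally minimal member (`j(W) ∈ {0, 54000, −12288000}`):
`Λ(V) ⊆ Λ(W)`.  Why it might fail: a non-étale step to a `j = 54000` / `−12288000` member — the Vélu models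
`[0,0,0,−15c²,22c³] ← [0,0,0,0,c³]`, `[0,0,0,−135c²,−594c³] ← [0,0,0,0,−27c³]` and the `27a3 → 27a4`-type 3-isogenies are
étale on minimal models, so it does not; census CM-REROOT-v1: 1848/1848.  [cite: Stevens1989, Thm. (2.3), §5] -/
@[conjecture]
def CMTwinStevensMinimalThree : Prop :=
  ∀ (V W : WeierstrassCurve ℚ) [V.IsElliptic] [V.IsGloballyMinimal] [W.IsElliptic] [W.IsGloballyMinimal]
    (LV LW : PeriodPair),
    V.j = 0 → WeierstrassCurve.IsIsogenous V W →
    IsNeronLatticeOf (V.baseChange ℂ) LV → IsNeronLatticeOf (W.baseChange ℂ) LW →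
    (∀ (W' : WeierstrassCurve ℚ) [W'.IsElliptic] [W'.IsGloballyMinimal],
        W'.j = 0 → WeierstrassCurve.IsIsogenous V W' → (W'.c₆ = V.c₆ ∨ W'.c₆ = -27 * V.c₆)) →
    LV.lattice ≤ LW.lattice

/-- E-es-133⁺₂ ⟹ E-es-133₂ (drop the use of `W.j = 1728`). -/
theorem cmTwinLatticeLeTwo_of_stevensMinimal (h : CMTwinStevensMinimalTwo) : CMTwinLatticeLeTwo :=
  fun V W _ _ _ _ LV LW hjV _ hiso hLV hLW hred => h V W LV LW hjV hiso hLV hLW hred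

end Laws

/-! ## §4 COROLLARIES 6⁺ / 7⁺ — C2 / C3 on the CM classes from TWO laws (kernel-checked) -/

section Corollaries

-- (typer) `isNewformOf_of_isIsogenous` = the tree's `…KatoCurve.CMOptimal.isNewformOf_of_isIsogenous` (opened above).

/-- **COROLLARY 6⁺ (C2 on every `ℚ(i)`-CM class off the two unit classes, from TWO laws).**
E-es-134₂^loc ∧ E-es-133⁺₂ (∧ Faltings' `LFunction_eq_of_isIsogenous`) ⟹ for EVERY globally minimal `W` isogenous to a
twist-reduced `j = 1728` twin `V` of conductor `∉ {32, 64}` and every optimal datum `D` of `W` (lattice clause):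
`2² ∣ N → 2 ∤ c(D)` — C2's literal shape; no hypothesis on `j(W)`, no E-es-135. -/
theorem not_two_dvd_maninConstant_on_cmClass_two
    (hΛ : CMPeriodLatticeLawTwoLocal) (hmin : CMTwinStevensMinimalTwo) (hL : LFunction_eq_of_isIsogenous)
    (W : WeierstrassCurve ℚ) [W.IsElliptic] [W.IsGloballyMinimal] {N : ℕ} [NeZero N]
    (D : ModularParametrizationData W N)
    (hD : ∀ z ∈ D.L.lattice, ∃ w ∈ periodLattice D.f, z = D.c * w)
    (V : WeierstrassCurve ℚ) [V.IsElliptic] [V.IsGloballyMinimal] (LV : PeriodPair)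
    (hjV : V.j = 1728) (hiso : WeierstrassCurve.IsIsogenous V W)
    (hLV : IsNeronLatticeOf (V.baseChange ℂ) LV)
    (hred : ∀ (W' : WeierstrassCurve ℚ) [W'.IsElliptic] [W'.IsGloballyMinimal],
        W'.j = 1728 → WeierstrassCurve.IsIsogenous V W' → (W'.c₄ = V.c₄ ∨ W'.c₄ = -4 * V.c₄))
    (h32 : V.conductorNorm ℤ ≠ 32) (h64 : V.conductorNorm ℤ ≠ 64) :
    2 ^ 2 ∣ N → ¬ (2 : ℤ) ∣ D.maninConstant := fun _ =>
  not_dvd_maninConstant_of_saturated_cuspSymbol_mem D hD Int.prime_two LV.lattice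
    (hmin V W LV D.L hjV hiso hLV D.isNeronLattice hred)
    (hΛ V D.f LV hjV (isNewformOf_of_isIsogenous hL D.isNewformOf hiso) hLV hred h32 h64)

/-- **COROLLARY 7⁺ (C3 on every `ℚ(√−3)`-CM class off `27a`, from TWO laws).** -/
theorem not_three_dvd_maninConstant_on_cmClass_three
    (hΛ : CMPeriodLatticeLawThreeLocal) (hmin : CMTwinStevensMinimalThree) (hL : LFunction_eq_of_isIsogenous)
    (W : WeierstrassCurve ℚ) [W.IsElliptic] [W.IsGloballyMinimal] {N : ℕ} [NeZero N]
    (D : ModularParametrizationData W N)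
    (hD : ∀ z ∈ D.L.lattice, ∃ w ∈ periodLattice D.f, z = D.c * w)
    (V : WeierstrassCurve ℚ) [V.IsElliptic] [V.IsGloballyMinimal] (LV : PeriodPair)
    (hjV : V.j = 0) (hiso : WeierstrassCurve.IsIsogenous V W)
    (hLV : IsNeronLatticeOf (V.baseChange ℂ) LV)
    (hred : ∀ (W' : WeierstrassCurve ℚ) [W'.IsElliptic] [W'.IsGloballyMinimal],
        W'.j = 0 → WeierstrassCurve.IsIsogenous V W' → (W'.c₆ = V.c₆ ∨ W'.c₆ = -27 * V.c₆))
    (h27 : V.conductorNorm ℤ ≠ 27) :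
    3 ^ 2 ∣ N → ¬ (3 : ℤ) ∣ D.maninConstant := fun _ =>
  not_dvd_maninConstant_of_saturated_cuspSymbol_mem D hD Int.prime_three LV.lattice
    (hmin V W LV D.L hjV hiso hLV D.isNeronLattice hred)
    (hΛ V D.f LV hjV (isNewformOf_of_isIsogenous hL D.isNewformOf hiso) hLV hred h27)

/-- **COROLLARY 6⁺⁺ (full squeeze on every `ℚ(i)`-CM class off 32a/64a): T2Λ ∧ E-es-133⁺₂ ⟹ `c(D) = ±1`** — Manin's
conjecture up to sign for the optimal data of these classes, all primes at once (the tree's full law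
`CMPeriodLatticeLawTwo`, E-es-131-T2Λ). -/
theorem maninConstant_unit_on_cmClass_two
    (hΛ : CMPeriodLatticeLawTwo) (hmin : CMTwinStevensMinimalTwo) (hL : LFunction_eq_of_isIsogenous)
    (W : WeierstrassCurve ℚ) [W.IsElliptic] [W.IsGloballyMinimal] {N : ℕ} [NeZero N]
    (D : ModularParametrizationData W N)
    (hD : ∀ z ∈ D.L.lattice, ∃ w ∈ periodLattice D.f, z = D.c * w)
    (V : WeierstrassCurve ℚ) [V.IsElliptic] [V.IsGloballyMinimal] (LV : PeriodPair)
    (hjV : V.j = 1728) (hiso : WeierstrassCurve.IsIsogenous V W)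
    (hLV : IsNeronLatticeOf (V.baseChange ℂ) LV)
    (hred : ∀ (W' : WeierstrassCurve ℚ) [W'.IsElliptic] [W'.IsGloballyMinimal],
        W'.j = 1728 → WeierstrassCurve.IsIsogenous V W' → (W'.c₄ = V.c₄ ∨ W'.c₄ = -4 * V.c₄))
    (h32 : V.conductorNorm ℤ ≠ 32) (h64 : V.conductorNorm ℤ ≠ 64) :
    D.maninConstant = 1 ∨ D.maninConstant = -1 :=
  maninConstant_eq_one_or_eq_neg_one_of_cuspSymbol_mem D hD LV.lattice
    (hΛ V D.f LV hjV (isNewformOf_of_isIsogenous hL D.isNewformOf hiso) hLV hred h32 h64)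
    (hmin V W LV D.L hjV hiso hLV D.isNeronLattice hred)

/-- **COROLLARY 7⁺⁺ (full squeeze on every `ℚ(√−3)`-CM class off 27a): T3Λ ∧ E-es-133⁺₃ ⟹ `c(D) = ±1`.** -/
theorem maninConstant_unit_on_cmClass_three
    (hΛ : CMPeriodLatticeLawThree) (hmin : CMTwinStevensMinimalThree) (hL : LFunction_eq_of_isIsogenous)
    (W : WeierstrassCurve ℚ) [W.IsElliptic] [W.IsGloballyMinimal] {N : ℕ} [NeZero N]
    (D : ModularParametrizationData W N)
    (hD : ∀ z ∈ D.L.lattice, ∃ w ∈ periodLattice D.f, z = D.c * w)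
    (V : WeierstrassCurve ℚ) [V.IsElliptic] [V.IsGloballyMinimal] (LV : PeriodPair)
    (hjV : V.j = 0) (hiso : WeierstrassCurve.IsIsogenous V W)
    (hLV : IsNeronLatticeOf (V.baseChange ℂ) LV)
    (hred : ∀ (W' : WeierstrassCurve ℚ) [W'.IsElliptic] [W'.IsGloballyMinimal],
        W'.j = 0 → WeierstrassCurve.IsIsogenous V W' → (W'.c₆ = V.c₆ ∨ W'.c₆ = -27 * V.c₆))
    (h27 : V.conductorNorm ℤ ≠ 27) :
    D.maninConstant = 1 ∨ D.maninConstant = -1 :=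
  maninConstant_eq_one_or_eq_neg_one_of_cuspSymbol_mem D hD LV.lattice
    (hΛ V D.f LV hjV (isNewformOf_of_isIsogenous hL D.isNewformOf hiso) hLV hred h27)
    (hmin V W LV D.L hjV hiso hLV D.isNeronLattice hred)

end Corollaries

/-! ## §5 E-es-135 anyway: the finite rerooting at `p = 2`, typed, and the kernel-checked reduction -/

section Rerooting

/-- **`CMClassShapeTwo` (classical CM + minimal-model bookkeeping; support, provable).**  A globally minimal `W` isogenous over
`ℚ` to an elliptic curve with `j = 1728` has CM by `ℤ[i]` or `ℤ[2i]` (class number one: `j(W) ∈ {1728, 287496}`), and in the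
second case `W` is the quadratic twist `32a3 ⊗ χ_d = [0,0,0,−11d²,−14d³]` for a unique squarefree `d ∈ ℤ`, a MINIMAL model,
so `(c₄(W), c₆(W)) = (528d², 12096d³)` (`d` odd: the `32a`-rooted family; `d = 2D`: `[0,0,0,−44D²,−112D³] = 64a2 ⊗ χ_D`, the
`64a`-rooted family).  Census CM-REROOT-v1: all 174 curves with `j = 287496` of conductor `< 500 000` have this shape with
`u = 1`; no other `j` occurs in the 649 classes.  [cite: Silverman1994, App. A §3 (class number one `j`-invariants)]
[cite: Stevens1989, §5 (5.6)–(5.7)] -/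
def CMClassShapeTwo : Prop :=
  ∀ (W V : WeierstrassCurve ℚ) [W.IsElliptic] [W.IsGloballyMinimal] [V.IsElliptic],
    V.j = 1728 → WeierstrassCurve.IsIsogenous V W →
    W.j = 1728 ∨ ∃ d : ℤ, Squarefree d ∧ W.c₄ = 528 * (d : ℚ) ^ 2 ∧ W.c₆ = 12096 * (d : ℚ) ^ 3

/-- **`CMUnitTwistOptimalCoordinatesTwo` — MEMO-es THEOREM 42.19 on the two `ℚ(i)` unit-twist families, in coordinates.**
If `W₀` is a globally minimal optimal model (`IsOptimalModel`: an `X₀(N(W₀))`-datum with the lattice clause) isogenous to a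
globally minimal `W` with `(c₄, c₆)(W) = (528d², 12096d³)`, `d` squarefree, then `c₆(W₀) = 0` (so `j(W₀) = 1728`) and `W₀` is
LOCATED: `[0,0,0,−d², 0]` (`c₄ = 48d²`) if `d` is odd with `d² ≠ 1`; `[0,0,0,D²,0]` (`c₄ = −48D² = −12d²`) if `d = 2D` with `d² ≠ 4`;
`32a1 = [0,0,0,4,0]` (`c₄ = −192`) if `d² = 1`; `64a1 = [0,0,0,−4,0]` (`c₄ = 192`) if `d² = 4`.  SOURCE: `E₀(K ⊗ χ_D) = E∗(K) ⊗ χ_D`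
for `K ∈ {32a, 64a}`, `D ≡ 1 (mod 4)` squarefree, `D ≠ 1` — MEMO-es THEOREM 42.19 = tree LEMMA⁺
(`GaussSumMulMemGamma1OfMemGamma0Twist_holds`) + Stevens 1989 Thm (1.5)=(7.1) [I″ at `M ≤ 200`] + Lemma (5.2) + Cor (5.3) +
Thm (2.3); and Cremona's table at conductors 32, 64 for the roots.  Why it might fail: only through Stevens' range
computation (7.1) at `M = 32, 64` (a finite modular-symbol computation, re-certifiable).  Census CM-REROOT-v1: `E₀ = E∗(K) ⊗ χ_D`
in 50/50 + 35/35 twisted classes, roots `E₀(32a) = 32a1`, `E₀(64a) = 64a1`.  [cite: Stevens1989, Thm. (1.5), Lemma (5.2),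
Cor. (5.3), Thm. (2.3)] [cite: Cremona1997, Table 1, N = 32, 64] -/
def CMUnitTwistOptimalCoordinatesTwo : Prop :=
  ∀ (W₀ W : WeierstrassCurve ℚ) [W₀.IsElliptic] [W₀.IsGloballyMinimal] [W.IsElliptic] [W.IsGloballyMinimal],
    IsOptimalModel W₀ → WeierstrassCurve.IsIsogenous W₀ W →
    ∀ d : ℤ, Squarefree d → W.c₄ = 528 * (d : ℚ) ^ 2 → W.c₆ = 12096 * (d : ℚ) ^ 3 →
    W₀.c₆ = 0 ∧
      (Odd d → d ^ 2 ≠ 1 → W₀.c₄ = 48 * (d : ℚ) ^ 2) ∧ (Even d → d ^ 2 ≠ 4 → W₀.c₄ = -12 * (d : ℚ) ^ 2) ∧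
      (d ^ 2 = 1 → W₀.c₄ = -192) ∧ (d ^ 2 = 4 → W₀.c₄ = 192)

/-- **E-es-135₂ from the rerooting (kernel-checked).**  `CMClassShapeTwo ∧ CMUnitTwistOptimalCoordinatesTwo` (∧ Carayol's
`level = conductor`, tree fact `IsNewformOf.level_eq_conductorNorm`) ⟹ g29's `CMOptimalIsFullCMTwo`: an optimal datum on a
globally minimal `W` isogenous to a `j = 1728` curve forces `j(W) = 1728` — because a `j = 287496` member has `c₆ = 12096d³ ≠ 0`
while the located optimal curve has `c₆ = 0`. -/
theorem cmOptimalIsFullCMTwo_of_rerooting (hshape : CMClassShapeTwo) (hloc : CMUnitTwistOptimalCoordinatesTwo)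
    (hN : ∀ (N : ℕ) [NeZero N], IsNewformOf.level_eq_conductorNorm (N := N)) : CMOptimalIsFullCMTwo := by
  intro W _ _ N _ D hD V _ hjV hiso
  rcases hshape W V hjV hiso with hj | ⟨d, hd, hc4, hc6⟩
  · exact hj
  · exfalso
    have hNW : N = W.conductorNorm ℤ := hN N D.isNewformOf
    subst hNW
    have hopt : IsOptimalModel W := ⟨inferInstance, D, hD⟩
    have h0 : W.c₆ = 0 := (hloc W W hopt (isIsogenous_self (W := W)) d hd hc4 hc6).1
    have hd0 : (d : ℚ) ≠ 0 := by exact_mod_cast hd.ne_zero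
    have : (12096 : ℚ) * (d : ℚ) ^ 3 ≠ 0 := mul_ne_zero (by norm_num) (pow_ne_zero 3 hd0)
    exact this (hc6 ▸ h0)

end Rerooting

/-! ## §6 NEW: the ROOT LAWS E-es-136 / E-es-137 (MEMO-es §44.C) -/

section RootLaws

/-- **E-es-136₂ `CMRootGammaOneLatticeLawTwoLocal` — the 2-primary STEVENS law on the squarefree root family.**
`V` globally minimal with `(c₄, c₆) = (−48a, 0)`, `a` squarefree, i.e. `V ≅ E_a = [0,0,0,a,0]` (a ROOT twin: `v₂(a) ≤ 1`,
no odd square factor); `f` its normalised newform on `Γ₀(N)`; `L` a Néron pair.  Then an ODD multiple of every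
`Γ₁(N)`-period of `f` lies in `Λ(V)` — equivalently (given the `Γ₁` lattice clause) the `X₁(N)`-optimal curve of the class
is `E_a` and its `Γ₁`-Manin constant is odd: the 2-part of Stevens' Conjecture I″ (2.9) on this family.  In print ONLY at
`a = ±1` (`N = 32, 64`: Stevens Thm (7.1)); no exclusion is needed there.  Why it might fail: it is the 2-part of an `X₁`
statement on a CM family at the prime `2 ∣ w_{ℚ(i)}` — no Euler-system or visibility tool touches it; a single root `E_a`
with `X₁`-optimal curve `E_{−4a}` or even `c₁` kills it (data ask D-es-g30-2: `a ∈ {±2, ±3, ±5, ±6}`).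
THEOREM 44.C (paper): this law at the root `a(V)` implies E-es-134₂^loc at every NON-ROOT twist-reduced twin `V`.
[cite: Stevens1989, Conj. I″ (2.9), Thm. (7.1), Lemma (5.2), Lemma (5.4)] -/
@[conjecture]
def CMRootGammaOneLatticeLawTwoLocal : Prop :=
  ∀ (V : WeierstrassCurve ℚ) [V.IsElliptic] [V.IsGloballyMinimal] {N : ℕ} [NeZero N]
    (f : CuspForm (Gamma0 N) 2) (L : PeriodPair),
    (∃ a : ℤ, Squarefree a ∧ V.c₄ = -48 * (a : ℚ) ∧ V.c₆ = 0) →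
    IsNewformOf V f → IsNeronLatticeOf (V.baseChange ℂ) L →
    ∀ z ∈ periodLatticeGamma1 f, ∃ s : ℤ, ¬ (2 : ℤ) ∣ s ∧ (s : ℂ) * z ∈ L.lattice

/-- **E-es-137₂ `CMRootPeriodLatticeLawTwoLocal` — E-es-134₂^loc restricted to ROOT classes** (extra binder: `V ≅ E_a`,
`a` squarefree; the exclusions `N ≠ 32, 64` are `a ≠ ∓1`).  On a root class `{E_a, E_{−4a}}` it says: the `X₀`-optimal curve
is `E_a` and `c₀` is odd.  BC5: Cremona optimality `E₀ = E_a` in 123/123 root classes with `a² ≠ 1`, `N < 5·10⁵`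
(CM-REROOT-v1 / BAND-STRATA-v1); false at `a = ±1` (`E₀(32a) = E_4`, `E₀(64a) = E_{−4}`), whence the exclusions.
[cite: Stevens1989, Thm. (2.3)] [Cremona allcurves `N < 5·10⁵`] -/
@[conjecture]
def CMRootPeriodLatticeLawTwoLocal : Prop :=
  ∀ (V : WeierstrassCurve ℚ) [V.IsElliptic] [V.IsGloballyMinimal] {N : ℕ} [NeZero N]
    (f : CuspForm (Gamma0 N) 2) (L : PeriodPair),
    (∃ a : ℤ, Squarefree a ∧ V.c₄ = -48 * (a : ℚ) ∧ V.c₆ = 0) →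
    V.j = 1728 → IsNewformOf V f → IsNeronLatticeOf (V.baseChange ℂ) L →
    (∀ (W : WeierstrassCurve ℚ) [W.IsElliptic] [W.IsGloballyMinimal],
        W.j = 1728 → WeierstrassCurve.IsIsogenous V W → (W.c₄ = V.c₄ ∨ W.c₄ = -4 * V.c₄)) →
    V.conductorNorm ℤ ≠ 32 → V.conductorNorm ℤ ≠ 64 →
    ∀ γ : Gamma0 N, ∃ s : ℤ, ¬ (2 : ℤ) ∣ s ∧ (s : ℂ) * cuspSymbol f γ ∈ L.lattice

/-- E-es-134₂^loc ⟹ E-es-137₂ (literal restriction). -/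
theorem cmRootPeriodLatticeLawTwoLocal_of_law (h : CMPeriodLatticeLawTwoLocal) : CMRootPeriodLatticeLawTwoLocal :=
  fun V _ _ _ _ f L _ hj hf hL hred h32 h64 γ => h V f L hj hf hL hred h32 h64 γ

/-- **E-es-136₃ `CMRootGammaOneLatticeLawThreeLocal` — the 3-primary STEVENS law on the `j = 0` root family.**
`V` globally minimal, `c₄(V) = 0`, `c₆(V) = −864·B` with `v_p(B) ≤ 2` at every prime `p ≥ 5` and `v₃(B) ≤ 2` (a ROOT:
`V ≅ E_B = [0,0,0,0,B]` up to the `2`-adic rescaling of the `a₃ = 1` models, no cube factor `d³`, `3 ∤ d`, to twist away);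
conclusion: a prime-to-`3` multiple of every `Γ₁(N)`-period lies in `Λ(V)`.  In print at the roots of conductor `≤ 200`
(`27a`, `36a`, `108a`, `144a`: Stevens Thm (7.1)).  THEOREM 44.C₃ (paper): implies E-es-134₃^loc at every non-root twin
`E_{c·d³}`, `gcd(d, 6) = 1`, `d ≠ 1`.  [cite: Stevens1989, Conj. I″ (2.9), Thm. (7.1), Lemma (5.2), Lemma (5.4)] -/
@[conjecture]
def CMRootGammaOneLatticeLawThreeLocal : Prop :=
  ∀ (V : WeierstrassCurve ℚ) [V.IsElliptic] [V.IsGloballyMinimal] {N : ℕ} [NeZero N]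
    (f : CuspForm (Gamma0 N) 2) (L : PeriodPair),
    (∃ B : ℚ, B ≠ 0 ∧ V.c₄ = 0 ∧ V.c₆ = -864 * B ∧ padicValRat 3 B ≤ 2 ∧
        ∀ p : ℕ, p.Prime → 5 ≤ p → padicValRat p B ≤ 2) →
    IsNewformOf V f → IsNeronLatticeOf (V.baseChange ℂ) L →
    ∀ z ∈ periodLatticeGamma1 f, ∃ s : ℤ, ¬ (3 : ℤ) ∣ s ∧ (s : ℂ) * z ∈ L.lattice

/-- **E-es-137₃ `CMRootPeriodLatticeLawThreeLocal` — E-es-134₃^loc restricted to `j = 0` ROOT classes.**  BC5: Cremona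
optimality `E₀ = V` at every `j = 0` root class of conductor `< 5·10⁵` other than `27a` (CM-REROOT-v1: 1847/1847 off `27a`). -/
@[conjecture]
def CMRootPeriodLatticeLawThreeLocal : Prop :=
  ∀ (V : WeierstrassCurve ℚ) [V.IsElliptic] [V.IsGloballyMinimal] {N : ℕ} [NeZero N]
    (f : CuspForm (Gamma0 N) 2) (L : PeriodPair),
    (∃ B : ℚ, B ≠ 0 ∧ V.c₄ = 0 ∧ V.c₆ = -864 * B ∧ padicValRat 3 B ≤ 2 ∧
        ∀ p : ℕ, p.Prime → 5 ≤ p → padicValRat p B ≤ 2) →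
    V.j = 0 → IsNewformOf V f → IsNeronLatticeOf (V.baseChange ℂ) L →
    (∀ (W : WeierstrassCurve ℚ) [W.IsElliptic] [W.IsGloballyMinimal],
        W.j = 0 → WeierstrassCurve.IsIsogenous V W → (W.c₆ = V.c₆ ∨ W.c₆ = -27 * V.c₆)) →
    V.conductorNorm ℤ ≠ 27 →
    ∀ γ : Gamma0 N, ∃ s : ℤ, ¬ (3 : ℤ) ∣ s ∧ (s : ℂ) * cuspSymbol f γ ∈ L.lattice

/-- E-es-134₃^loc ⟹ E-es-137₃ (literal restriction). -/
theorem cmRootPeriodLatticeLawThreeLocal_of_law (h : CMPeriodLatticeLawThreeLocal) :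
    CMRootPeriodLatticeLawThreeLocal :=
  fun V _ _ _ _ f L _ hj hf hL hred h27 γ => h V f L hj hf hL hred h27 γ

/-- Sanity edge: on a ROOT twin the `Γ₁`-law is implied by the `Γ₀`-law (`Λ₁(f) ≤ Λ_f`, tree
`periodLatticeGamma1_le_periodLattice`) — so E-es-136₂ is the WEAKER statement exactly where E-es-137₂ is defined, and the
content of THEOREM 44.C is that this weaker root statement propagates to the whole twisted family. -/
theorem cmRootGammaOne_of_gammaZero_pointwise {N : ℕ} [NeZero N] (f : CuspForm (Gamma0 N) 2) (L : PeriodPair)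
    (h : ∀ γ : Gamma0 N, ∃ s : ℤ, ¬ (2 : ℤ) ∣ s ∧ (s : ℂ) * cuspSymbol f γ ∈ L.lattice) :
    ∀ z ∈ periodLatticeGamma1 f, ∃ s : ℤ, ¬ (2 : ℤ) ∣ s ∧ (s : ℂ) * z ∈ L.lattice := by
  intro z hz
  have hz' : z ∈ periodLattice f := periodLatticeGamma1_le_periodLattice f hz
  -- `periodLattice f` is the closure of the cusp symbols; induct over the closure.
  refine AddSubgroup.closure_induction (p := fun w _ => ∃ s : ℤ, ¬ (2 : ℤ) ∣ s ∧ (s : ℂ) * w ∈ L.lattice)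
    ?_ ?_ ?_ ?_ hz'
  · rintro _ ⟨γ, rfl⟩
    exact h γ
  · exact ⟨1, by decide, by simp⟩
  · rintro x y _ _ ⟨s, hs, hsx⟩ ⟨t, ht, hty⟩
    refine ⟨s * t, ?_, ?_⟩
    · rintro ⟨k, hk⟩
      have h2 : (2 : ℤ) ∣ s * t := ⟨k, hk⟩
      rcases (Int.prime_two.dvd_mul).1 h2 with h | h
      · exact hs h
      · exact ht h
    · have hx' : ((s * t : ℤ) : ℂ) * x ∈ L.lattice := by
        have e : ((s * t : ℤ) : ℂ) * x = (t : ℤ) • ((s : ℂ) * x) := by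
          rw [zsmul_eq_mul]; push_cast; ring
        rw [e]; exact L.lattice.smul_mem t hsx
      have hy' : ((s * t : ℤ) : ℂ) * y ∈ L.lattice := by
        have e : ((s * t : ℤ) : ℂ) * y = (s : ℤ) • ((t : ℂ) * y) := by
          rw [zsmul_eq_mul]; push_cast; ring
        rw [e]; exact L.lattice.smul_mem s hty
      simpa [mul_add] using L.lattice.add_mem hx' hy'
  · rintro x _ ⟨s, hs, hsx⟩
    exact ⟨s, hs, by simpa [mul_neg] using L.lattice.neg_mem hsx⟩

end RootLaws

end Summit.BirchSwinnertonDyer.Rank1Residual.ManinAdditive.KatoCurve.CMTwinMinimal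

end
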